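import Literature.NumberTheory.EllipticCurves.BSDRankZeroFamily
import Literature.NumberTheory.EllipticCurves.ShortWeierstrassGoodTwistLocalProofs
import Literature.NumberTheory.EllipticCurves.QuadraticTwistTwoLFunctionProofs
import HarnessLib

/-!
# Bhargava–Shankar §4.1: `ω(E₋₁) = −ω(E)` on the root-number family, from the Modularity Theorem

`Proofs` companion of `Literature/NumberTheory/EllipticCurves/BSDRankZeroFamily.lean`, which vendors the
sentence "`ω(E) = −ω(E₋₁)` for all `E ∈ F`" of M. Bhargava, A. Shankar, *Ternary cubic forms having
bounded invariants, and the existence of a positive proportion of elliptic curves having rank 0*, Ann. of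
Math. (2) 181 (2015) 587–621 = arXiv:1007.0052v2, §4.1, restricted to the subfamily `IsBSFamily`
(`A ≡ 4 (mod 8)`, `4A³ + 27B² ≡ ±2¹⁴ (mod 2¹⁶)` with matching sign, squarefree away from `2`), as the named
fact `rootNumber_negB_of_isBSFamily` (for the tree's *analytic* root number `WeierstrassCurve.rootNumber`).
This file **proves that fact from the Modularity Theorem `exists_isNewformOf` alone**
(`rootNumber_negB_of_isBSFamily_of_exists_isNewformOf`).

## The argument (coprime twisting instead of local root numbers at `2`)

The source computes `ω = −∏_p ω_p` with S. Wong's `ω₂(E) = −ω₂(E₋₁)` for curves additive at `2` with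
`2`-adic unit `j` (Compositio Math. 127 (2001), Lemma 12) — local root numbers at additive places over `2`,
which the tree does not have (`WeierstrassCurve.localRootNumber` is junk there). Instead:

* **`2`-adic shape** (`exists_bsParams`, two kernel-decided residue computations mod `512` and mod `64`):
  a member of the subfamily is `(A, B) = (4a, 16εc)`, `ε = ±1`, with `a = 16α + 8τ − 3`,
  `c = 32β + 8α + 8τ² + 4τ − 1`, `τ ∈ {0, 1}`;
* **the good curve** `E⁰ = E_{a,2c}`: `⟨2, −1, 1, 4τ⟩ • E⁰ = [1, −1, τ, α, β]` (`smul_shortWeierstrass_bsGood`)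
  with `4A³ + 27B² = −2¹⁴ Δ([1, −1, τ, α, β])`, so the family's conditions say exactly that
  `Δ₀ = Δ([1, −1, τ, α, β])` is odd, squarefree, with `|Δ₀| ≡ 1 (mod 4)` (`natAbs_mod_four_of_bsResidue`);
  hence `E⁰` has good reduction at `2` (`hasGoodReductionAt_two_bsGood`; e.g. `(A, B) = (20, 176)` gives
  `E⁰ = [1, −1, 1, 0, 0] = 53a1`, `(−44, 48)` gives `[1, −1, 1, −1, 0] = 17a4`) and odd squarefree conductor
  `N = |Δ₀| ≡ 1 (mod 4)` (`conductorNorm_bsGood`, Ogg's formula at good and multiplicative primes,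
  Silverman *ATAEC* IV.10.2, proved in the tree);
* **the twists**: `E_{4a,16c} = (E⁰)^{(2)}` and `E_{4a,−16c} = (E⁰)^{(−2)}` on the nose
  (`quadraticTwist_two_shortWeierstrass`, `quadraticTwist_neg_two_shortWeierstrass`), i.e. `{E, E₋₁}` is
  `{E⁰ ⊗ χ₈, E⁰ ⊗ χ₈'}`; by the coprime twisting theorem from Modularity (Murty–Murty 1997, Ch. 6 §1;
  `rootNumber_quadraticTwist_neg_two_eq_neg` of `QuadraticTwistTwoLFunctionProofs`)
  `w((E⁰)^{(2)}) = χ₈(N) w(E⁰)` and `w((E⁰)^{(−2)}) = −χ₈'(N) w(E⁰) = −χ₈(N) w(E⁰)` as `N ≡ 1 (mod 4)`.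

(Locally at `2` this is the source's mechanism: `ω₂(E⁰ ⊗ χ) = χ₂(−1)` for `E⁰` good at `2`, and
`χ₈(−1) = 1 = −χ₈'(−1)`.) The result agrees with the numerical table of `BSDRankZeroFamilyProofs`
(`w(E_{20,176}) = +1 = χ₈(−53)·w(53a1)`, `w(E_{−44,48}) = +1 = χ₈(−17)·w(17a4)`).

## Main results

* `exists_bsParams`, `smul_shortWeierstrass_bsGood`, `negDisc_bsGood`, `hasGoodReductionAt_two_bsGood`,
  `conductorNorm_bsGood` : the `2`-adic shape, the good model, its conductor.
* `rootNumber_negB_of_isBSFamily_of_exists_isNewformOf` : **the named fact from `exists_isNewformOf`**.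
* `exists_isLarge_rootNumber_twist_family_of_exists_isNewformOf_bs`, `pos_proportion_rank_zero_of_facts₂'` :
  the composite fact of `BSDRankZeroDensity` realised with the source's own family, and Thm 4 of the
  source from Thm 27, Thm 42 and Modularity (compare `pos_proportion_rank_zero_of_facts₄` of
  `BSDRankZeroGoodTwistFamilyProofs`, which uses the substitute family of `37a1`).

Everything is proved; no definitions and no named facts are introduced (D-0026). The two residue lemmas
are closed by `decide +kernel` and are stated before `open scoped Classical`; the second needs a larger
typeclass-synthesis budget for its nested bounded quantifiers (`synthInstance.maxSize`).

## References

* [BhargavaShankarTernary2015] M. Bhargava, A. Shankar, Ann. of Math. (2) 181 (2015) 587–621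
  = arXiv:1007.0052v2, §4.1 (the family `F`, "ω(E) = −ω(E₋₁) for all E ∈ F"), Thm 4, Thm 27, Thm 42.
* [MurtyMurty1997] M. R. Murty, V. K. Murty, *Non-vanishing of `L`-functions and applications* (1997),
  Ch. 6, §1.
* [SilvermanAEC2009] J. H. Silverman, *The Arithmetic of Elliptic Curves*, 2nd ed. (2009), III.1,
  VII.1 Rem. 1.1, VII.5 Prop. 5.1.
* [Silverman1994] J. H. Silverman, *Advanced Topics in the Arithmetic of Elliptic Curves* (1994), IV.10.2.
* S. Wong, *On the density of elliptic curves*, Compositio Math. 127 (2001), Lemma 12 (the source's route,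
  not used here).
-/

/-! ### Two residue computations (kernel `decide`; stated before `open scoped Classical`) -/

namespace Literature.NumberTheory.EllipticCurves

/-- Residues modulo `512`: `27 r² ≡ 256 (mod 512)` forces `16 ∥ r`. [folklore] -/
theorem bs_aux_mod512 : ∀ n : ℕ, n < 512 → (256 + 27 * n ^ 2) % 512 = 0 → n % 16 = 0 ∧ n % 32 ≠ 0 := by
  decide +kernel

-- the nested bounded quantifiers (`Nat.decidableBallLT`) need a larger typeclass-synthesis budget
set_option synthInstance.maxHeartbeats 200000 in
set_option synthInstance.maxSize 1024 in
/-- Residues: for odd `n, m` with `n³ + 27 m² ≡ 0 (mod 64)`, with `τ = [n ≡ 5 (mod 16)]` and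
`c' = ±m ≡ 3 (mod 4)`: `16 ∣ n + 3 − 8τ` and `64 ∣ 2c' − n − 1 − 16τ`. [folklore] -/
theorem bs_aux_mod64 : ∀ n : ℕ, n < 64 → ∀ m : ℕ, m < 32 → n % 2 = 1 → m % 2 = 1 →
    (n ^ 3 + 27 * m ^ 2) % 64 = 0 →
      (n + 3 + 16 - 8 * (if n % 16 = 5 then 1 else 0)) % 16 = 0 ∧
      (2 * (if m % 4 = 3 then m else 64 - m) + 128 - n - 1 - 16 * (if n % 16 = 5 then 1 else 0)) % 64 = 0 := by
  decide +kernel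

end Literature.NumberTheory.EllipticCurves

noncomputable section

open scoped Classical

namespace Literature.NumberTheory.EllipticCurves

open IsDedekindDomain WeierstrassCurve Rat.HeightOneSpectrum NumberField
open Literature.NumberTheory.EllipticCurves.RankZeroSieve Literature.NumberTheory.EllipticCurves.ModularForms

/-! ### The `2`-adic shape of the subfamily -/

/-- **The `2`-adic shape of the subfamily.** If `A ≡ 4 (mod 8)` and `2¹⁴ ∣ 4A³ + 27B²` then
`A = 4a`, `B = ±16c'` with `a = 16α + 8τ − 3`, `c' = 32β + 8α + 8τ² + 4τ − 1`, `τ ∈ {0, 1}`: the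
coordinates in which `⟨2, −1, 1, 4τ⟩ • E_{a, 2c'}` is the integral model `[1, −1, τ, α, β]`. [folklore] -/
theorem exists_bsParams {A B : ℤ} (hA : A ≡ 4 [ZMOD 8]) (hD : (2 : ℤ) ^ 14 ∣ negDisc (A, B)) :
    ∃ α β τ ε : ℤ, (τ = 0 ∨ τ = 1) ∧ (ε = 1 ∨ ε = -1) ∧
      A = 4 * (16 * α + 8 * τ - 3) ∧ B = 16 * ε * (32 * β + 8 * α + 8 * τ ^ 2 + 4 * τ - 1) := by
  -- `A = 4a`, `a` odd
  have hA' : A % 8 = 4 := hA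
  obtain ⟨a, rfl, ha⟩ : ∃ a : ℤ, A = 4 * a ∧ a % 2 = 1 := ⟨A / 4, by omega, by omega⟩
  rw [negDisc_apply] at hD
  have ha3 : a ^ 3 % 2 = 1 := Int.odd_iff.mp ((Int.odd_iff.mpr ha).pow)
  -- `B = 16c`, `c` odd
  have h512 : (512 : ℤ) ∣ 256 + 27 * B ^ 2 := by
    have h1 : (2 : ℤ) ^ 9 ∣ 4 * (4 * a) ^ 3 + 27 * B ^ 2 := (pow_dvd_pow 2 (by norm_num)).trans hD
    have e : a ^ 3 - 1 = 2 * ((a ^ 3 - 1) / 2) := by omega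
    have h2 : (4 * (4 * a) ^ 3 + 27 * B ^ 2 : ℤ) = 256 + 27 * B ^ 2 + 512 * ((a ^ 3 - 1) / 2) := by
      linear_combination 256 * e
    rw [h2] at h1
    norm_num at h1
    omega
  obtain ⟨c, rfl, hc⟩ : ∃ c : ℤ, B = 16 * c ∧ c % 2 = 1 := by
    set r : ℤ := B % 512 with hr
    obtain ⟨q, hq⟩ : ∃ q : ℤ, B = 512 * q + r := ⟨B / 512, by omega⟩
    have hsq : B ^ 2 = r ^ 2 + 512 * (512 * q ^ 2 + 2 * q * r) := by rw [hq]; ring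
    have hr0 : 0 ≤ r := Int.emod_nonneg B (by norm_num)
    have hr1 : r < 512 := Int.emod_lt_of_pos B (by norm_num)
    obtain ⟨n, hn⟩ := Int.eq_ofNat_of_zero_le hr0
    have hn512 : n < 512 := by omega
    have hmod : (256 + 27 * n ^ 2) % 512 = 0 := by
      have h1 : (512 : ℤ) ∣ 256 + 27 * r ^ 2 := by
        rw [hsq] at h512
        have e : (256 + 27 * (r ^ 2 + 512 * (512 * q ^ 2 + 2 * q * r)) : ℤ) =
            256 + 27 * r ^ 2 + 512 * (27 * (512 * q ^ 2 + 2 * q * r)) := by ring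
        rw [e] at h512
        exact (Int.dvd_add_left (dvd_mul_right _ _)).mp h512
      rw [hn] at h1
      have h2 : ((512 : ℕ) : ℤ) ∣ ((256 + 27 * n ^ 2 : ℕ) : ℤ) := by push_cast; exact h1
      have h3 := Int.natCast_dvd_natCast.mp h2
      omega
    obtain ⟨h16, h32⟩ := bs_aux_mod512 n hn512 hmod
    exact ⟨B / 16, by omega, by omega⟩
  -- `64 ∣ a³ + 27c²`
  have h64 : (64 : ℤ) ∣ a ^ 3 + 27 * c ^ 2 := by
    have e : (4 * (4 * a) ^ 3 + 27 * (16 * c) ^ 2 : ℤ) = 256 * (a ^ 3 + 27 * c ^ 2) := by ring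
    rw [e, show (2 : ℤ) ^ 14 = 256 * 64 by norm_num] at hD
    exact (mul_dvd_mul_iff_left (by norm_num : (256 : ℤ) ≠ 0)).mp hD
  -- the sign `ε` and `c' = εc ≡ 3 (mod 4)`; `τ`
  set ε : ℤ := if c % 4 = 3 then 1 else -1 with hε
  set c' : ℤ := ε * c with hc'
  set τ : ℤ := if a % 16 = 5 then 1 else 0 with hτ
  have hε1 : ε = 1 ∨ ε = -1 := by rw [hε]; split_ifs <;> simp
  have hτ1 : τ = 0 ∨ τ = 1 := by rw [hτ]; split_ifs <;> simp
  -- residues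
  set n : ℕ := (a % 64).toNat with hndef
  set m : ℕ := (c % 32).toNat with hmdef
  have hn : (n : ℤ) = a % 64 := Int.toNat_of_nonneg (Int.emod_nonneg a (by norm_num))
  have hm : (m : ℤ) = c % 32 := Int.toNat_of_nonneg (Int.emod_nonneg c (by norm_num))
  have hn64 : n < 64 := by have := Int.emod_lt_of_pos a (show (0 : ℤ) < 64 by norm_num); omega
  have hm32 : m < 32 := by have := Int.emod_lt_of_pos c (show (0 : ℤ) < 32 by norm_num); omega
  obtain ⟨qa, hqa⟩ : ∃ q : ℤ, a = 64 * q + n := ⟨a / 64, by omega⟩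
  obtain ⟨qc, hqc⟩ : ∃ q : ℤ, c = 32 * q + m := ⟨c / 32, by omega⟩
  have hnodd : n % 2 = 1 := by omega
  have hmodd : m % 2 = 1 := by omega
  have hkey : (n ^ 3 + 27 * m ^ 2) % 64 = 0 := by
    have e : a ^ 3 + 27 * c ^ 2 = ((n : ℤ) ^ 3 + 27 * (m : ℤ) ^ 2) +
        64 * (4096 * qa ^ 3 + 192 * qa ^ 2 * n + 3 * qa * n ^ 2 + 27 * (16 * qc ^ 2 + qc * m)) := by
      rw [hqa, hqc]; ring
    rw [e] at h64
    have h1 : (64 : ℤ) ∣ (n : ℤ) ^ 3 + 27 * (m : ℤ) ^ 2 := (Int.dvd_add_left (dvd_mul_right _ _)).mp h64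
    have h2 : ((64 : ℕ) : ℤ) ∣ ((n ^ 3 + 27 * m ^ 2 : ℕ) : ℤ) := by push_cast; exact h1
    have h3 := Int.natCast_dvd_natCast.mp h2
    omega
  obtain ⟨k1, k2⟩ := bs_aux_mod64 n hn64 m hm32 hnodd hmodd hkey
  -- back to integers
  have hτn : τ = if n % 16 = 5 then 1 else 0 := by
    rw [hτ]
    by_cases h5 : n % 16 = 5
    · rw [if_pos h5, if_pos (by omega)]
    · rw [if_neg h5, if_neg (by omega)]
  have hc'm : 2 * c' % 64 = (2 * ((if m % 4 = 3 then m else 64 - m : ℕ) : ℤ)) % 64 := by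
    rw [hc', hε]
    by_cases h3 : m % 4 = 3
    · rw [if_pos h3, if_pos (by omega)]; omega
    · rw [if_neg h3, if_neg (by omega)]
      have hm64 : m ≤ 64 := by omega
      rw [Nat.cast_sub hm64]
      push_cast
      omega
  have d16 : (16 : ℤ) ∣ a + 3 - 8 * τ := by
    rw [hτn]
    split_ifs at k1 ⊢ with h5 <;> omega
  have d64 : (64 : ℤ) ∣ 2 * c' - a - 1 - 16 * τ ^ 2 := by
    have hτsq : τ ^ 2 = τ := by rcases hτ1 with h | h <;> simp [h]
    rw [hτsq, hτn]
    split_ifs at k1 k2 hc'm ⊢ with h5 h3 <;> omega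
  obtain ⟨α, hα⟩ := d16
  obtain ⟨β, hβ⟩ := d64
  refine ⟨α, β, τ, ε, hτ1, hε1, by omega, ?_⟩
  have hεsq : ε * ε = 1 := by rcases hε1 with h | h <;> simp [h]
  have hcc : c = ε * c' := by rw [hc', ← mul_assoc, hεsq, one_mul]
  have hc'eq : c' = 32 * β + 8 * α + 8 * τ ^ 2 + 4 * τ - 1 := by omega
  rw [hcc, hc'eq]
  ring


/-! ### The good curve `E⁰ = E_{a,2c'}` and its twists by `±2` -/

/-- **`E_{a,b}^{(d)} = E_{d²a, d³b}`** on the nose for the tree's `WeierstrassCurve.quadraticTwist`.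
[folklore] -/
theorem quadraticTwist_intCast_shortWeierstrass (a b d : ℤ) :
    (shortWeierstrass (a, b)).quadraticTwist (d : ℚ) = shortWeierstrass (d ^ 2 * a, d ^ 3 * b) := by
  ext <;> simp [quadraticTwist, shortWeierstrass, b₂, b₄, b₆] <;> ring

/-- `E_{a,2c}^{(2)} = E_{4a,16c}`. [folklore] -/
theorem quadraticTwist_two_shortWeierstrass (a c : ℤ) :
    (shortWeierstrass (a, 2 * c)).quadraticTwist 2 = shortWeierstrass (4 * a, 16 * c) := by
  rw [show (2 : ℚ) = ((2 : ℤ) : ℚ) by norm_num, quadraticTwist_intCast_shortWeierstrass,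
    show (2 : ℤ) ^ 2 * a = 4 * a by ring, show (2 : ℤ) ^ 3 * (2 * c) = 16 * c by ring]

/-- `E_{a,2c}^{(−2)} = E_{4a,−16c}`. [folklore] -/
theorem quadraticTwist_neg_two_shortWeierstrass (a c : ℤ) :
    (shortWeierstrass (a, 2 * c)).quadraticTwist (-2) = shortWeierstrass (4 * a, -(16 * c)) := by
  rw [show (-2 : ℚ) = ((-2 : ℤ) : ℚ) by norm_num, quadraticTwist_intCast_shortWeierstrass,
    show (-2 : ℤ) ^ 2 * a = 4 * a by ring, show (-2 : ℤ) ^ 3 * (2 * c) = -(16 * c) by ring]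

/-- **The good model at `2`**: for `a = 16α + 8τ − 3`, `c = 32β + 8α + 8τ² + 4τ − 1`,
`⟨2, −1, 1, 4τ⟩ • E_{a,2c} = [1, −1, τ, α, β]` (`x = 4x' − 1`, `y = 8y' + 4x' + 4τ`).
[cite: SilvermanAEC2009, III.1 Table 3.1] -/
theorem smul_shortWeierstrass_bsGood (α β τ : ℤ) :
    (⟨Units.mk0 2 two_ne_zero, -1, 1, 4 * τ⟩ : VariableChange ℚ) •
        shortWeierstrass (16 * α + 8 * τ - 3, 2 * (32 * β + 8 * α + 8 * τ ^ 2 + 4 * τ - 1)) =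
      (⟨1, -1, τ, α, β⟩ : WeierstrassCurve ℤ).map (Int.castRingHom ℚ) := by
  ext <;> simp only [variableChange_a₁, variableChange_a₂, variableChange_a₃, variableChange_a₄,
    variableChange_a₆, Units.val_inv_eq_inv_val, Units.val_mk0, shortWeierstrass, map_a₁, map_a₂,
    map_a₃, map_a₄, map_a₆, eq_intCast] <;> push_cast <;> field_simp <;> ring

/-- `4a³ + 27(2c)² = −2⁸ Δ([1, −1, τ, α, β])` for `a = 16α + 8τ − 3`, `c = 32β + 8α + 8τ² + 4τ − 1`.
[folklore] -/
theorem negDisc_bsGood (α β τ : ℤ) :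
    negDisc (16 * α + 8 * τ - 3, 2 * (32 * β + 8 * α + 8 * τ ^ 2 + 4 * τ - 1)) =
      -256 * (⟨1, -1, τ, α, β⟩ : WeierstrassCurve ℤ).Δ := by
  simp only [negDisc_apply, WeierstrassCurve.Δ, WeierstrassCurve.b₂, WeierstrassCurve.b₄,
    WeierstrassCurve.b₆, WeierstrassCurve.b₈]
  ring

/-- `4(4a)³ + 27(±16c)² = 64 · (4a³ + 27(2c)²)`. [folklore] -/
theorem negDisc_bsClass (a c ε : ℤ) (hε : ε = 1 ∨ ε = -1) :
    negDisc (4 * a, 16 * ε * c) = 64 * negDisc (a, 2 * c) := by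
  have hε2 : ε ^ 2 = 1 := by rcases hε with rfl | rfl <;> norm_num
  simp only [negDisc_apply]
  linear_combination (27 * 256 * c ^ 2) * hε2

section Local

variable (v : HeightOneSpectrum (𝓞 ℚ))

/-- **`E_{a,2c}` has good reduction at `2`** when `Δ([1, −1, τ, α, β])` is odd (the model
`[1, −1, τ, α, β]` is `2`-integral with unit discriminant; Silverman VII.5 Prop. 5.1(a)).
[cite: SilvermanAEC2009, VII.1 Remark 1.1 and VII.5 Prop. 5.1(a)] -/
theorem hasGoodReductionAt_two_bsGood (hv : natGenerator v = 2) {α β τ a c : ℤ}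
    (ha : a = 16 * α + 8 * τ - 3) (hc : c = 32 * β + 8 * α + 8 * τ ^ 2 + 4 * τ - 1)
    (hodd : ¬ (2 : ℤ) ∣ (⟨1, -1, τ, α, β⟩ : WeierstrassCurve ℤ).Δ) :
    (shortWeierstrass (a, 2 * c)).HasGoodReductionAt v := by
  subst ha hc
  have hodd' : ¬ ((primesEquiv v : ℕ) : ℤ) ∣ (⟨1, -1, τ, α, β⟩ : WeierstrassCurve ℤ).Δ := by
    rw [show ((primesEquiv v : ℕ) : ℤ) = (natGenerator v : ℤ) from rfl, hv]; exact_mod_cast hodd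
  have hg := hasGoodReductionAt_map_of_not_dvd _ v hodd'
  rw [← smul_shortWeierstrass_bsGood] at hg
  exact (hasGoodReductionAt_smul_iff_holds v _ _).mp hg

/-- `E_{a,2c}` is elliptic when `Δ([1, −1, τ, α, β]) ≠ 0` (`4a³ + 27(2c)² = −2⁸Δ`). [folklore] -/
theorem isElliptic_bsGood {α β τ a c : ℤ}
    (ha : a = 16 * α + 8 * τ - 3) (hc : c = 32 * β + 8 * α + 8 * τ ^ 2 + 4 * τ - 1)
    (h0 : (⟨1, -1, τ, α, β⟩ : WeierstrassCurve ℤ).Δ ≠ 0) :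
    (shortWeierstrass (a, 2 * c)).IsElliptic := by
  subst ha hc
  refine isElliptic_shortWeierstrass_of_negDisc_ne_zero ?_
  rw [negDisc_bsGood]
  exact mul_ne_zero (by norm_num) h0

/-- **The conductor of `E_{a,2c}` is `|Δ([1, −1, τ, α, β])|`** when this discriminant is odd and
`4a³ + 27(2c)²` is squarefree away from `2`: `f₂ = 0` (good reduction), and at odd `p`, `f_p = 0`
(`p ∤ Δ`, good) or `f_p = 1` (`p ∥ Δ`, multiplicative), by Silverman *ATAEC* IV.10.2(a),(b)
(`conductorExponent_eq_zero_iff`, `conductorExponent_eq_one_iff`, proved in the tree).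
[cite: Silverman1994, IV.10.2(a),(b)] -/
theorem conductorNorm_bsGood {α β τ a c : ℤ}
    (ha : a = 16 * α + 8 * τ - 3) (hc : c = 32 * β + 8 * α + 8 * τ ^ 2 + 4 * τ - 1)
    (hodd : ¬ (2 : ℤ) ∣ (⟨1, -1, τ, α, β⟩ : WeierstrassCurve ℤ).Δ) (hsq : OddSqfree (a, 2 * c))
    [(shortWeierstrass (a, 2 * c)).IsElliptic] :
    (shortWeierstrass (a, 2 * c)).conductorNorm ℤ = ((⟨1, -1, τ, α, β⟩ : WeierstrassCurve ℤ).Δ).natAbs := by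
  set W := shortWeierstrass (a, 2 * c) with hW
  set d : ℤ := -(⟨1, -1, τ, α, β⟩ : WeierstrassCurve ℤ).Δ with hd
  have hdodd : ¬ (2 : ℤ) ∣ d := by rwa [hd, dvd_neg]
  have hd0 : d ≠ 0 := fun h ↦ hdodd (by rw [h]; exact dvd_zero _)
  have hD : negDisc (a, 2 * c) = 256 * d := by rw [ha, hc, negDisc_bsGood, hd]; ring
  rw [show ((⟨1, -1, τ, α, β⟩ : WeierstrassCurve ℤ).Δ).natAbs = d.natAbs by rw [hd, Int.natAbs_neg]]
  refine Nat.eq_of_factorization_eq (W.conductorNorm_pos_holds).ne' (Int.natAbs_ne_zero.mpr hd0)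
    fun p ↦ ?_
  by_cases hp : p.Prime
  swap
  · rw [Nat.factorization_eq_zero_of_not_prime _ hp, Nat.factorization_eq_zero_of_not_prime _ hp]
  set v : HeightOneSpectrum (𝓞 ℚ) := (primesEquiv (R := 𝓞 ℚ)).symm ⟨p, hp⟩ with hv
  have hvp : natGenerator v = p := natGenerator_primesEquiv_symm_ringOfIntegers ⟨p, hp⟩
  rw [factorization_conductorNorm_eq_conductorExponent W ⟨p, hp⟩]
  change W.conductorExponent v = _
  by_cases hp2 : p = 2
  · -- good reduction at `2`
    subst hp2
    rw [(conductorExponent_eq_zero_iff_holds v W).mpr (hasGoodReductionAt_two_bsGood v hvp ha hc hodd)]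
    rw [Nat.factorization_eq_zero_of_not_dvd]
    intro h
    exact hdodd (Int.dvd_natAbs.mp (by exact_mod_cast h))
  have hv2 : natGenerator v ≠ 2 := by rwa [hvp]
  by_cases hpd : (p : ℤ) ∣ d
  · -- multiplicative reduction: `f_p = 1`, `p ∥ d`
    have hpD : (natGenerator v : ℤ) ∣ negDisc (a, 2 * c) := by
      rw [hD, hvp]; exact hpd.trans (dvd_mul_left _ _)
    have hpD2 : ¬ (natGenerator v : ℤ) ^ 2 ∣ negDisc (a, 2 * c) := by
      rw [hvp]; exact hsq p hp hp2
    rw [(conductorExponent_eq_one_iff_holds v W).mpr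
      (hasMultiplicativeReductionAt_shortWeierstrass_of_dvd v hv2 hpD hpD2)]
    have h1 : p ∣ d.natAbs := by
      rw [← Int.natCast_dvd_natCast, Int.dvd_natAbs]; exact hpd
    have h2 : ¬ p ^ 2 ∣ d.natAbs := by
      intro h
      apply hpD2
      rw [hD, hvp]
      have : ((p : ℤ) ^ 2) ∣ d := by
        rw [← Int.dvd_natAbs]; exact_mod_cast h
      exact this.trans (dvd_mul_left _ _)
    have hle : 1 ≤ d.natAbs.factorization p :=
      (hp.pow_dvd_iff_le_factorization (Int.natAbs_ne_zero.mpr hd0)).mp (by rwa [pow_one])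
    have hlt : ¬ 2 ≤ d.natAbs.factorization p := fun h' ↦
      h2 ((hp.pow_dvd_iff_le_factorization (Int.natAbs_ne_zero.mpr hd0)).mpr h')
    omega
  · -- good reduction: `f_p = 0`, `p ∤ d`
    have hpD : ¬ (natGenerator v : ℤ) ∣ negDisc (a, 2 * c) := by
      rw [hD, hvp]
      intro h
      rcases (Nat.prime_iff_prime_int.mp hp).dvd_or_dvd h with h | h
      · have : (p : ℤ) ∣ 2 ^ 8 := by norm_num at h ⊢; exact h
        have := (Nat.prime_iff_prime_int.mp hp).dvd_of_dvd_pow this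
        exact hp2 ((Nat.prime_dvd_prime_iff_eq hp Nat.prime_two).mp (by exact_mod_cast this))
      · exact hpd h
    rw [(conductorExponent_eq_zero_iff_holds v W).mpr
      (hasGoodReductionAt_shortWeierstrass_of_not_dvd v hv2 hpD)]
    rw [Nat.factorization_eq_zero_of_not_dvd]
    intro h
    exact hpd (Int.dvd_natAbs.mp (by exact_mod_cast h))

end Local

/-! ### The sign and residue conditions of the subfamily, read on `Δ([1, −1, τ, α, β])` -/

/-- If `D = −2¹⁴ Δ₀`, `D ≡ ±2¹⁴ (mod 2¹⁶)` with the sign of `D` matching, then `Δ₀` is odd and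
`|Δ₀| ≡ 1 (mod 4)` (the third condition `Δ' ≡ 1 (mod 4)` of the source's family). [folklore] -/
theorem natAbs_mod_four_of_bsResidue {s : Bool} {D Δ₀ : ℤ} (hD : D = -2 ^ 14 * Δ₀)
    (hres : D ≡ bsResidue s [ZMOD 2 ^ 16]) (hsign : if s then 0 < D else D < 0) :
    (Δ₀.natAbs : ℤ) % 4 = 1 ∧ ¬ (2 : ℤ) ∣ Δ₀ := by
  have h := hres.dvd
  subst hD
  cases s
  · simp only [bsResidue, Bool.false_eq_true, ↓reduceIte] at h hsign
    norm_num at h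
    have hpos : 0 < Δ₀ := by linarith
    rw [Int.natAbs_of_nonneg hpos.le]
    omega
  · simp only [bsResidue, ↓reduceIte] at h hsign
    norm_num at h
    have hneg : Δ₀ < 0 := by linarith
    rw [Int.ofNat_natAbs_of_nonpos hneg.le]
    omega

/-! ### The root-number sentence on the subfamily, from the Modularity Theorem -/

/-- **`ω(E_{A,−B}) = −ω(E_{A,B})` on the subfamily `IsBSFamily`, from the Modularity Theorem**
(the named fact `rootNumber_negB_of_isBSFamily` of `BSDRankZeroFamily`, i.e. Bhargava–Shankar's §4.1
sentence "`ω(E) = −ω(E₋₁)` for all `E ∈ F`" restricted to `v₂(A) = 2`, granted `exists_isNewformOf`).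
Proof: a member is `(A, B) = (4a, ±16c)` with `E⁰ = E_{a,2c}` of good reduction at `2` and odd
squarefree conductor `N ≡ 1 (mod 4)` (`exists_bsParams`, `conductorNorm_bsGood`,
`natAbs_mod_four_of_bsResidue`); `E_{4a,16c} = (E⁰)^{(2)}` and `E_{4a,−16c} = (E⁰)^{(−2)}` are the
twists of `E⁰` by the primitive quadratic characters `χ₈`, `χ₈'` of conductor `8 ⊥ N`
(`LFunction_quadraticTwist_two_apply`, `…_neg_two_apply`), so by Atkin–Lehner–Li coprime twisting
from Modularity (`rootNumber_eq_of_cuspCoeff_eq_twist`; Murty–Murty 1997, Ch. 6 §1)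
`w((E⁰)^{(2)}) = χ₈(−1)χ₈(N) w(E⁰) = χ₈(N) w(E⁰)` and `w((E⁰)^{(−2)}) = χ₈'(−1)χ₈'(N) w(E⁰) = −χ₈(N) w(E⁰)`.
[cite: BhargavaShankarTernary2015, §4.1 (arXiv v2), "ω(E) = −ω(E₋₁) for all E ∈ F"]
[cite: MurtyMurty1997, Ch. 6 §1] -/
theorem rootNumber_negB_of_isBSFamily_of_exists_isNewformOf (hmod : exists_isNewformOf) :
    rootNumber_negB_of_isBSFamily := by
  rintro s ⟨A, B⟩ ⟨hA, hDres, hsq, hsign⟩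
  replace hA : A ≡ 4 [ZMOD 8] := hA
  -- the `2`-adic shape
  have h14 : (2 : ℤ) ^ 14 ∣ negDisc (A, B) := by
    have h := hDres.dvd
    cases s
    · simp only [bsResidue, Bool.false_eq_true, ↓reduceIte] at h
      norm_num at h ⊢
      omega
    · simp only [bsResidue, ↓reduceIte] at h
      norm_num at h ⊢
      omega
  obtain ⟨α, β, τ, ε, hτ, hε, hAeq, hBeq⟩ := exists_bsParams hA h14
  set a : ℤ := 16 * α + 8 * τ - 3 with ha
  set c : ℤ := 32 * β + 8 * α + 8 * τ ^ 2 + 4 * τ - 1 with hc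
  set M : WeierstrassCurve ℤ := ⟨1, -1, τ, α, β⟩ with hM
  -- `4A³ + 27B² = −2¹⁴ Δ(M)`: parity, residue and sign of `Δ(M)`
  have hD64 : negDisc (A, B) = 64 * negDisc (a, 2 * c) := by
    rw [hAeq, hBeq]; exact negDisc_bsClass a c ε hε
  have hD : negDisc (A, B) = -2 ^ 14 * M.Δ := by
    rw [hD64, ha, hc, negDisc_bsGood]; ring
  obtain ⟨hN4, hodd⟩ := natAbs_mod_four_of_bsResidue hD hDres hsign
  have hΔ0 : M.Δ ≠ 0 := fun h ↦ hodd (by rw [h]; exact dvd_zero _)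
  -- the good curve `E⁰ = E_{a,2c}`
  set E0 : WeierstrassCurve ℚ := shortWeierstrass (a, 2 * c) with hE0
  haveI hell : E0.IsElliptic := isElliptic_bsGood ha hc hΔ0
  have hsq0 : OddSqfree (a, 2 * c) := by
    intro p hp hp2 hdvd
    exact hsq p hp hp2 (by rw [hD64]; exact hdvd.trans (dvd_mul_left _ _))
  have hgood : ∀ w : HeightOneSpectrum (𝓞 ℚ), natGenerator w = 2 → E0.HasGoodReductionAt w :=
    fun w hw ↦ hasGoodReductionAt_two_bsGood w hw ha hc hodd
  have hN : E0.conductorNorm ℤ = M.Δ.natAbs := conductorNorm_bsGood ha hc hodd hsq0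
  have hN4' : E0.conductorNorm ℤ % 4 = 1 := by rw [hN]; omega
  -- the twists by `±2`: `w(E⁰^{(−2)}) = −w(E⁰^{(2)})` as `N ≡ 1 (mod 4)`
  have key : (shortWeierstrass (4 * a, -(16 * c))).rootNumber =
      -(shortWeierstrass (4 * a, 16 * c)).rootNumber := by
    rw [← quadraticTwist_two_shortWeierstrass, ← quadraticTwist_neg_two_shortWeierstrass]
    exact E0.rootNumber_quadraticTwist_neg_two_eq_neg hmod hN4' hgood
  -- conclusion, according to the sign `ε`
  show (shortWeierstrass (A, -B)).rootNumber = -(shortWeierstrass (A, B)).rootNumber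
  rw [hAeq, hBeq]
  rcases hε with rfl | rfl
  · rw [show (16 : ℤ) * 1 * c = 16 * c by ring]
    exact key
  · rw [show -((16 : ℤ) * (-1) * c) = 16 * c by ring, show (16 : ℤ) * (-1) * c = -(16 * c) by ring, key,
      neg_neg]

/-- **The composite existence fact of `BSDRankZeroDensity` with the source's own §4.1 family**, from the
Modularity Theorem: `exists_isLarge_rootNumber_twist_family` holds with the two sign pieces
`bsFamilies` of `BSDRankZeroFamily` (`exists_isLarge_rootNumber_twist_family_of_rootNumber_negB`
composed with `rootNumber_negB_of_isBSFamily_of_exists_isNewformOf`).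
[cite: BhargavaShankarTernary2015, §4.1 (arXiv v2), construction of F] -/
theorem exists_isLarge_rootNumber_twist_family_of_exists_isNewformOf_bs (hmod : exists_isNewformOf) :
    exists_isLarge_rootNumber_twist_family :=
  exists_isLarge_rootNumber_twist_family_of_rootNumber_negB
    (rootNumber_negB_of_isBSFamily_of_exists_isNewformOf hmod)

/-- **Theorem 4 of Bhargava–Shankar with the §4.1 family, the root-number input discharged by
Modularity**: `pos_proportion_rank_zero` from Thm 27 (`heightAverageOn_card_selmerThree_le_four`),
Thm 42 (Dokchitser–Dokchitser, `even_selmerRank_sub_torsionRank_iff`) and `exists_isNewformOf`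
(`pos_proportion_rank_zero_of_facts₂` with `h₄` supplied by
`rootNumber_negB_of_isBSFamily_of_exists_isNewformOf`).
[cite: BhargavaShankarTernary2015, Thm 4 and §4.1 (arXiv v2 numbering)] -/
theorem pos_proportion_rank_zero_of_facts₂' (h₁ : heightAverageOn_card_selmerThree_le_four)
    (h₃ : even_selmerRank_sub_torsionRank_iff) (hmod : exists_isNewformOf) : pos_proportion_rank_zero :=
  pos_proportion_rank_zero_of_facts₂ h₁ h₃ (rootNumber_negB_of_isBSFamily_of_exists_isNewformOf hmod)

end Literature.NumberTheory.EllipticCurves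

end
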